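import Mathlib
import Literature.MathematicalPhysics.QuantumFieldTheory.Balaban1983to89.B9SectDL2Decay

/-!
# `Balaban1983to89.B9SectDSup` — [Balaban1985BackgroundPropagators] Sect. D, Theorem 3.12 p. 423: the SUP/HÖLDER
half of the Neumann series (3.130)/(3.138), KERNEL-CHECKED as a FACTORED block-majorant induction (the perturbation
step G₀Δ′_π = 𝒢∘𝒯 routed through an auxiliary "sup ⊕ Hölder" state space), with the constants, the rate loss and the
smallness of *"for α₀ sufficiently small"* EXPLICIT

CITATION HEADER (lean-in-tree rule 2026-08-18).  Source under reading: T. Bałaban, *Propagators for lattice gauge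
theories in a background field*, Commun. Math. Phys. **99**, 389–434 (1985), doi:10.1007/bf01240355
[`Balaban1985BackgroundPropagators`] (cell paper B9; held `paper:balaban1985-cmp99-background-propagators`; journal
page = PDF page + 388; every quotation below is read from the page renders
`b2b-balaban-ref1/pages/1985-cmp99-background-propagators/…-p009,p010,p011,p031,p033,p034,p035-x2.png`), and T. Bałaban,
*Propagators and renormalization transformations for lattice gauge theories. II*, Commun. Math. Phys. **96**, 223–250
(1984) [`Balaban1984PropagatorsII`] (cell paper B6 = ref. [4] of B9), Lemma 2.1 p. 234.  PRINTED INPUTS (theorem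
STATEMENTS only, never the disputed steps): Theorem 3.1 p. 397 (3.42): *"|(G′(U)λ)(x)|, |(∇_UG′(U)λ)(x)|,
|(G′(U)∇*_Uλ)(x)|, |(Δ_UG′(U)λ)(x)| ≤ B₀[(L^jη)², L^jη, L^jη, 1]e^{−δ₀d(y,y′)}|λ| for x ∈ Δ(y), y ∈ Λ_j, supp λ ⊂
Δ(y′)"*; (3.43)–(3.45) p. 398 (the Hölder and mixed entries, constants B₀(β₀), B′₀(ε), B′₀(ε,β₀)); the remark of
p. 398: *"Using Lemma 2.1 in [4] we may replace the factor (L^jη)^α by (L^jη)^β(L^{j′}η)^γ with β + γ = α, j, j′ are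
indices of localizations. It is easy to see that the global inequalities (3.47) are consequences of the local ones
(3.42) and Lemma 2.1."*; Theorem 3.3 p. 399 (the same for G(U) = G₀); (3.49) p. 399; (3.120) p. 419 and (3.130)
p. 421: *"G = G₀(I − Δ′_πG₀)⁻¹ = Σ_{n=0}^∞ G₀(Δ′_πG₀)ⁿ. (3.130)"* (so that G = G₀ + G₀Δ′_πG₀ + ⋯ — our gloss, not
printed), *"we have to be careful only with the third term in the definition (3.120) of Δ′_π. One of the three
derivatives there has to be applied either to an expression on the right, or on the left, of Δ′_π"*; p. 422:
*"This inequality and Theorem 3.3 for G₀ imply a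
convergence of the series (3.130), for α₀ sufficiently small, in all norms appearing on the left-hand sides of the
inequalities (3.42)–(3.47), except the inequality involving the Laplace operator in (3.42). Thus we have Theorem 3.3.
for G, with this exception."*; (3.138) and Theorem 3.12 p. 423: *"If an external gauge field configuration U
satisfies both regularity conditions (3.35), (3.36) for α₀ sufficiently small, then Theorems 3.3, 3.10, 3.11 hold for
the propagators G, G₁, with one exception and the inequality (1.133) together with Theorem 3.10 hold for the operators
H, H₁. The exception is the inequality in (3.42) involving the covariant Laplace operator. It does not hold for G,
G₁."* ([sic] "(1.133)": the paper has no Sect. 1 display of that number; (3.133) p. 422 is meant — cell flag F-1.133);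
[4] (2.54) (`B6RandomWalk.Triangle254`), Lemma 2.1
(2.60) (`B6RandomWalk.Ineq260`) and (2.61) (`B11SectG.RowSum`).

WHAT IS REPRODUCED.  The LOCATED GAP (cell GAPS G-B9-16 / G-pv21g2-1 (a)): for the SUP, HÖLDER, MIXED and GLOBAL
entries (3.42)₁₋₃, (3.43), (3.44), (3.45), (3.47)₁₋₃ of G = (Δ_π + DRD* + Q*aQ)⁻¹ and G₁ the paper asserts the
convergence of (3.130)/(3.138) "in all norms" with ONE displayed estimate ((3.131), an L¹ × L^∞ bound) and one
instruction (move one derivative of the third term of (3.120) onto the neighbouring G₀).  The cell's adversarial unit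
pv21-g2 showed (GAPS C-pv21g2-1) that a ONE-factor majorant of Δ′_πG₀ in a single sup class cannot work (it would
force a Calderón–Zygmund-false sup bound on ∇G′∇*); the companion md `HOME/b2b-balaban-r1/SectD-sup-proof.md`
(unit r1-g7) carries out the SIMULTANEOUS sup + Hölder induction: the state attached to each term of (3.130) is the
pair (sup size, covariant Hölder size) near every y ∈ 𝔅, packaged as ONE `B11SectG.BlockNorm` 𝔠; the step is FACTORED
G₀Δ′_π = 𝒢 ∘ 𝒯 through the auxiliary space P = F × F_s of pairs (φ, ψ) with G₀Δ′_πf = G₀φ(f) + G₀Dψ(f) — every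
leading derivative absorbed into G₀ — where 𝒯 : 𝔠 → 𝔭 is bounded from the printed (3.42)₃, (3.44) for G′ and (3.49),
and 𝒢 : 𝔭 → 𝔠 from (3.42)₁,₃, (3.43)₂ for G₀.  THIS MODULE kernel-checks the finite-dimensional bookkeeping skeleton
of that proof over ABSTRACT block-normed spaces: (a) the PRODUCT block norm on a product space (`prodNorm`; majorants
INTO a product add, `hasMaj_prod`; majorants OUT of a product, `hasMaj_coprod`) and the RESCALED block norm
(`weightNorm`, `HasMaj.weight`) carrying the scale weights (L^jη)^p of (3.42)–(3.47); (b) the symmetric forms of the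
rate bookkeeping of [4] (2.54) + (2.61) (`conv_exp_le_mirror`, `hasMaj_comp_exp_mirror`, under the symmetry of d
(2.46), `DistSymm`) and the scale transfer of the p. 398 remark in majorant form (`HasMaj.transfer`,
`HasMaj.transfer_mirror`, from [4] (2.60): cost L^t, rate αδ₀, under t·log L ≤ αδ₀RM); (c) the FACTORED fixed-point
algebra of (3.130): G = G₀ + 𝒢𝒯G ⇒ G𝒳 = G₀𝒳 + (𝒢𝒯)(G𝒳) and EG𝒳 = EG₀𝒳 + (E𝒢)(𝒯(G𝒳)) (`factored_rightEntry_fix`,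
`factored_entry_fix`); (d) the step majorant `step_majorant` (𝒦 = 𝒢𝒯 : 𝔠 → 𝔠 has θe^{−δd}, θ = κ_P·B_𝒢·C_𝒯·c);
(e) the RIGHT entries `rightEntry_majorant` / `rightEntry_of_factored` (G𝒳 : majorant A(1 − q)⁻¹e^{−ρd}, q = κθc,
from `B11SectG.neumann_majorant`, given the a priori bound of the finite lattice and q < 1) and the TWO-SIDED entries
`entry_majorant` (EG𝒳 : (A_{E𝒳} + κ_{P′}B_E·κC′_𝒯A′c·c)e^{−ρd}); (f) the global-from-local step of (3.47)
(`global_bound`: a majorant Ce^{−ρd} with ρ ≥ σ bounds sup_y of the output size by Cκc × sup_{y′} of the input size);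
(g) the smallness arithmetic (`inv_one_sub_le_two`, `mul_le_half_of_le_inv`): Mα₀ ≤ a_S := (2D)⁻¹ ⇒ q = D·Mα₀ ≤ ½ ⇒
(1 − q)⁻¹ ≤ 2 — the *"for α₀ sufficiently small"* of Theorem 3.12 LOCATED as one explicit constant.
CENSUS RESULT (with the md): the sup/Hölder/mixed/global entries of G, G₁ hold in the printed SHAPES with new constants
depending on d, L, N only and the rate (½ − 5β)δ₀ (β ∈ (0, 1/40] the rate at which Lemma 2.1 is used; β = 1/40 gives
⅜δ₀), under ONE smallness Mα₀ ≤ a_S(d, L, N); smallness is used exactly once ((e)); the Laplacian entry (3.42)₄ is the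
printed exception and is not touched.
WHAT IS *NOT* REPRODUCED OR ASSERTED: the lattice T_η, the Lie algebra 𝔤, the concrete sup / covariant-Hölder sizes
and the smooth partition of unity (md §2–§3, Lemma 3.A), the operator identity G₀Δ′_π = 𝒢𝒯 from (3.117)/(3.120) (md
Lemma 4.2), the derivation of the majorants of 𝒯, 𝒢 from (3.42)–(3.45), (3.49) (md Lemmas 4.1, 4.3) — here they
are hypotheses of the printed exponential shape; (3.42)₄/(3.47)₄; (3.46) (sibling `…B9SectDL2Decay`); (3.131),
(3.132), (3.133) (md §6, from the entries proved + the printed (3.132)); (3.134)–(3.137); Theorems 3.10, 3.11, 3.13.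
NOT used: any statement of the manuscripts under audit as a fact about their disputed steps; `Literature.Barriers`.

v1.1 (docstring-only over v1 p180467): the (3.130) and Theorem 3.12 quotations of this header re-typed VERBATIM from the
renders p033/p035 (v1 carried a gloss inside the (3.130) quotation marks and a paraphrase of Theorem 3.12); no declaration
changed.  Companion cell records (not part of the tree): `HOME/b2b-balaban-r1/SectD-sup-proof.md` (THEOREM S, COROLLARY H,
census §7), cell `GAPS.md` G-B9-16R3 / C-r1g7-1, `INTERFACES-A.md` IF-A-30, unit `b2b-balaban-r1-g7`.
-/

namespace Literature.MathematicalPhysics.QuantumFieldTheory.Balaban1983to89.B9SectDSup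

open Literature.MathematicalPhysics.QuantumFieldTheory.Balaban1983to89
open Finset B6RandomWalk B11SectG

variable {g : B6.Geometry}

/-! ## 1. Product and rescaled block norms (the state space 𝔭 = 𝔰 ⊕ 𝔰′ and the weights (L^jη)^p) -/

section Norms

variable {F₁ Fa Fb F₃ : Type} [AddCommGroup F₁] [Module ℝ F₁] [AddCommGroup Fa] [Module ℝ Fa]
  [AddCommGroup Fb] [Module ℝ Fb] [AddCommGroup F₃] [Module ℝ F₃]

/-- The PRODUCT block norm on Fa × Fb (pairs (φ, ψ) of a bond function and a site function, md §3.1): size = sum of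
the sizes, cut = the product of the cuts, localised = both components localised, cutting cost = the larger one.
[folklore] -/
def prodNorm (ba : BlockNorm g Fa) (bb : BlockNorm g Fb) : BlockNorm g (Fa × Fb) where
  loc y f := ba.loc y f.1 + bb.loc y f.2
  cut y := (ba.cut y).prodMap (bb.cut y)
  IsLoc y f := ba.IsLoc y f.1 ∧ bb.IsLoc y f.2
  κ := max ba.κ bb.κ
  κ_nonneg := ba.κ_nonneg.trans (le_max_left _ _)
  loc_nonneg y f := add_nonneg (ba.loc_nonneg y f.1) (bb.loc_nonneg y f.2)
  loc_zero y := by rw [Prod.fst_zero, Prod.snd_zero, ba.loc_zero, bb.loc_zero, add_zero]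
  loc_add_le y f f' := by
    rw [Prod.fst_add, Prod.snd_add]
    linarith [ba.loc_add_le y f.1 f'.1, bb.loc_add_le y f.2 f'.2]
  loc_neg y f := by rw [Prod.fst_neg, Prod.snd_neg, ba.loc_neg, bb.loc_neg]
  sum_cut f := by
    refine Prod.ext ?_ ?_
    · rw [Prod.fst_sum]
      simp only [LinearMap.prodMap_apply]
      exact ba.sum_cut f.1
    · rw [Prod.snd_sum]
      simp only [LinearMap.prodMap_apply]
      exact bb.sum_cut f.2
  isLoc_cut y f := by
    simp only [LinearMap.prodMap_apply]
    exact ⟨ba.isLoc_cut y f.1, bb.isLoc_cut y f.2⟩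
  loc_cut_le y f := by
    simp only [LinearMap.prodMap_apply]
    calc ba.loc y (ba.cut y f.1) + bb.loc y (bb.cut y f.2)
        ≤ ba.κ * ba.loc y f.1 + bb.κ * bb.loc y f.2 :=
          add_le_add (ba.loc_cut_le y f.1) (bb.loc_cut_le y f.2)
      _ ≤ max ba.κ bb.κ * ba.loc y f.1 + max ba.κ bb.κ * bb.loc y f.2 :=
          add_le_add (mul_le_mul_of_nonneg_right (le_max_left _ _) (ba.loc_nonneg y f.1))
            (mul_le_mul_of_nonneg_right (le_max_right _ _) (bb.loc_nonneg y f.2))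
      _ = max ba.κ bb.κ * (ba.loc y f.1 + bb.loc y f.2) := by ring

/-- The size of a pair is the sum of the sizes. [folklore] -/
@[simp] theorem prodNorm_loc (ba : BlockNorm g Fa) (bb : BlockNorm g Fb) (y : g.Site) (f : Fa × Fb) :
    (prodNorm ba bb).loc y f = ba.loc y f.1 + bb.loc y f.2 := rfl

/-- A pair is localised near y iff both components are. [folklore] -/
theorem prodNorm_isLoc (ba : BlockNorm g Fa) (bb : BlockNorm g Fb) (y : g.Site) (f : Fa × Fb) :
    (prodNorm ba bb).IsLoc y f ↔ ba.IsLoc y f.1 ∧ bb.IsLoc y f.2 := Iff.rfl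

/-- The cutting cost of the product is the larger of the two. [folklore] -/
@[simp] theorem prodNorm_κ (ba : BlockNorm g Fa) (bb : BlockNorm g Fb) : (prodNorm ba bb).κ = max ba.κ bb.κ := rfl

/-- Majorants INTO a product ADD: if φ = T_aμ has majorant K_a and ψ = T_bμ has K_b then (φ, ψ) has K_a + K_b (md
Lemma 4.3: C_𝒯 is the sum of the φ- and ψ-constants). [folklore] -/
theorem hasMaj_prod {b₁ : BlockNorm g F₁} {ba : BlockNorm g Fa} {bb : BlockNorm g Fb}
    {Ta : F₁ →ₗ[ℝ] Fa} {Tb : F₁ →ₗ[ℝ] Fb} {Ka Kb : g.Site → g.Site → ℝ}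
    (ha : HasMaj b₁ ba Ta Ka) (hb : HasMaj b₁ bb Tb Kb) :
    HasMaj b₁ (prodNorm ba bb) (Ta.prod Tb) (fun y y' => Ka y y' + Kb y y') := by
  intro y' μ hμ y
  rw [prodNorm_loc, LinearMap.prod_apply, add_mul]
  exact add_le_add (ha y' μ hμ y) (hb y' μ hμ y)

/-- Majorants OUT of a product: 𝒢(φ, ψ) = G_aφ + G_bψ has majorant K when both G_a and G_b have K (md Lemma 4.3 (G𝔠):
B_𝒢 after levelling the two rates). [folklore] -/
theorem hasMaj_coprod {ba : BlockNorm g Fa} {bb : BlockNorm g Fb} {b₃ : BlockNorm g F₃}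
    {Ga : Fa →ₗ[ℝ] F₃} {Gb : Fb →ₗ[ℝ] F₃} {K : g.Site → g.Site → ℝ}
    (ha : HasMaj ba b₃ Ga K) (hb : HasMaj bb b₃ Gb K) :
    HasMaj (prodNorm ba bb) b₃ (Ga.coprod Gb) K := by
  intro y' μ hμ y
  rw [prodNorm_isLoc] at hμ
  rw [LinearMap.coprod_apply, prodNorm_loc, mul_add]
  exact (b₃.loc_add_le y _ _).trans (add_le_add (ha y' μ.1 hμ.1 y) (hb y' μ.2 hμ.2 y))

/-- Two majorants with constants a, a′ and rates ρ ≤ ρ_a, ρ ≤ ρ_b level to the common (a + a′)e^{−ρd} (d ≥ 0). [folklore] -/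
theorem hasMaj_coprod_exp {ba : BlockNorm g Fa} {bb : BlockNorm g Fb} {b₃ : BlockNorm g F₃}
    {Ga : Fa →ₗ[ℝ] F₃} {Gb : Fb →ₗ[ℝ] F₃} {a a' ρa ρb ρ : ℝ} (hd : ∀ x y : g.Site, 0 ≤ g.dist x y)
    (ha0 : 0 ≤ a) (ha0' : 0 ≤ a') (hρa : ρ ≤ ρa) (hρb : ρ ≤ ρb)
    (ha : HasMaj ba b₃ Ga (fun y y' => a * Real.exp (-(ρa * g.dist y y'))))
    (hb : HasMaj bb b₃ Gb (fun y y' => a' * Real.exp (-(ρb * g.dist y y')))) :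
    HasMaj (prodNorm ba bb) b₃ (Ga.coprod Gb) (fun y y' => (a + a') * Real.exp (-(ρ * g.dist y y'))) := by
  have ha' := (ha.of_rate_le hd ha0 hρa).mono fun y y' =>
    (mul_le_mul_of_nonneg_right (le_add_of_nonneg_right ha0') (Real.exp_nonneg _) :
      a * Real.exp (-(ρ * g.dist y y')) ≤ (a + a') * Real.exp (-(ρ * g.dist y y')))
  have hb' := (hb.of_rate_le hd ha0' hρb).mono fun y y' =>
    (mul_le_mul_of_nonneg_right (le_add_of_nonneg_left ha0) (Real.exp_nonneg _) :
      a' * Real.exp (-(ρ * g.dist y y')) ≤ (a + a') * Real.exp (-(ρ * g.dist y y')))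
  exact hasMaj_coprod ha' hb'

/-- The RESCALED block norm: the local size multiplied by a weight W(y) ≥ 0 — the factors (L^jη)^{−p} of
(3.42)–(3.47) taken INSIDE the size (md §3.1: 𝔰^{(p)}, 𝔠^{(p)}). [folklore] -/
def weightNorm (b : BlockNorm g F₁) (W : g.Site → ℝ) (hW : ∀ y, 0 ≤ W y) : BlockNorm g F₁ where
  loc y f := W y * b.loc y f
  cut := b.cut
  IsLoc := b.IsLoc
  κ := b.κ
  κ_nonneg := b.κ_nonneg
  loc_nonneg y f := mul_nonneg (hW y) (b.loc_nonneg y f)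
  loc_zero y := by rw [b.loc_zero, mul_zero]
  loc_add_le y f f' :=
    (mul_le_mul_of_nonneg_left (b.loc_add_le y f f') (hW y)).trans_eq (mul_add _ _ _)
  loc_neg y f := by rw [b.loc_neg]
  sum_cut := b.sum_cut
  isLoc_cut := b.isLoc_cut
  loc_cut_le y f := by
    calc W y * b.loc y (b.cut y f) ≤ W y * (b.κ * b.loc y f) :=
          mul_le_mul_of_nonneg_left (b.loc_cut_le y f) (hW y)
      _ = b.κ * (W y * b.loc y f) := by ring

/-- The rescaled size is W(y) × the size. [folklore] -/
@[simp] theorem weightNorm_loc (b : BlockNorm g F₁) (W : g.Site → ℝ) (hW : ∀ y, 0 ≤ W y) (y : g.Site) (f : F₁) :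
    (weightNorm b W hW).loc y f = W y * b.loc y f := rfl

/-- Rescaling does not change localisation. [folklore] -/
theorem weightNorm_isLoc (b : BlockNorm g F₁) (W : g.Site → ℝ) (hW : ∀ y, 0 ≤ W y) (y : g.Site) (f : F₁) :
    (weightNorm b W hW).IsLoc y f ↔ b.IsLoc y f := Iff.rfl

/-- Rescaling does not change the cutting cost. [folklore] -/
@[simp] theorem weightNorm_κ (b : BlockNorm g F₁) (W : g.Site → ℝ) (hW : ∀ y, 0 ≤ W y) :
    (weightNorm b W hW).κ = b.κ := rfl

/-- Moving scale weights between the kernel and the sizes: a majorant K between b₁, b₂ is a majorant K′ between the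
rescaled norms as soon as W₂(y)K(y,y′) ≤ K′(y,y′)W₁(y′) — the printed remark *"the choice of powers L^jη is
conventional"* (p. 398), exact part. [cite: Balaban1985BackgroundPropagators, p.398 (remark after (3.47))] -/
theorem HasMaj.weight {b₁ : BlockNorm g F₁} {b₂ : BlockNorm g F₃} {T : F₁ →ₗ[ℝ] F₃}
    {K K' : g.Site → g.Site → ℝ} {W₁ W₂ : g.Site → ℝ} (hW₁ : ∀ y, 0 ≤ W₁ y) (hW₂ : ∀ y, 0 ≤ W₂ y)
    (h : HasMaj b₁ b₂ T K) (hKK' : ∀ y y', W₂ y * K y y' ≤ K' y y' * W₁ y') :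
    HasMaj (weightNorm b₁ W₁ hW₁) (weightNorm b₂ W₂ hW₂) T K' := by
  intro y' μ hμ y
  rw [weightNorm_isLoc] at hμ
  rw [weightNorm_loc, weightNorm_loc]
  calc W₂ y * b₂.loc y (T μ) ≤ W₂ y * (K y y' * b₁.loc y' μ) :=
        mul_le_mul_of_nonneg_left (h y' μ hμ y) (hW₂ y)
    _ = (W₂ y * K y y') * b₁.loc y' μ := by ring
    _ ≤ (K' y y' * W₁ y') * b₁.loc y' μ := mul_le_mul_of_nonneg_right (hKK' y y') (b₁.loc_nonneg y' μ)
    _ = K' y y' * (W₁ y' * b₁.loc y' μ) := by ring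

end Norms

/-! ## 2. Rate bookkeeping, symmetric forms; the scale transfer of p. 398 in majorant form -/

section Rates

variable {F₁ F₂ F₃ : Type} [AddCommGroup F₁] [Module ℝ F₁] [AddCommGroup F₂] [Module ℝ F₂]
  [AddCommGroup F₃] [Module ℝ F₃]

/-- The symmetry d(y, y′) = d(y′, y) of the multiscale distance (2.46) of [4] (an infimum of lengths of contours
joining the two blocks). [cite: Balaban1984PropagatorsII, (2.46) p.231] -/
def DistSymm (g : B6.Geometry) : Prop :=
  ∀ a b : g.Site, g.dist a b = g.dist b a

/-- Under the symmetry of d, the row sum (2.61) is also the column sum. [cite: Balaban1984PropagatorsII, (2.61) p.234] -/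
theorem colSum_of_rowSum {σ c : ℝ} (hsym : DistSymm g) (hrow : RowSum g σ c) (y' : g.Site) :
    ∑ y : g.Site, Real.exp (-(σ * g.dist y y')) ≤ c := by
  have := hrow y'
  calc ∑ y : g.Site, Real.exp (-(σ * g.dist y y')) = ∑ y : g.Site, Real.exp (-(σ * g.dist y' y)) :=
        Finset.sum_congr rfl fun y _ => by rw [hsym y y']
    _ ≤ c := this

/-- (2.54) + (2.61), MIRRORED: Σ_{y″} e^{−ρ₁d(y,y″)}e^{−ρ₂d(y″,y′)} ≤ c·e^{−ρd(y,y′)} whenever ρ ≤ ρ₁ and ρ + σ ≤ ρ₂ —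
the row sum now spent on the SECOND factor (needs the symmetry of d). [cite: Balaban1984PropagatorsII, (2.54)–(2.56) p.233 + (2.61) p.234] -/
theorem conv_exp_le_mirror {ρ₁ ρ₂ ρ σ c : ℝ} (hsym : DistSymm g) (htri : Triangle254 g)
    (hd : ∀ a b : g.Site, 0 ≤ g.dist a b) (hrow : RowSum g σ c) (hρ : 0 ≤ ρ) (hρ₁ : ρ ≤ ρ₁)
    (hρ₂ : ρ + σ ≤ ρ₂) (y y' : g.Site) :
    ∑ y'' : g.Site, Real.exp (-(ρ₁ * g.dist y y'')) * Real.exp (-(ρ₂ * g.dist y'' y')) ≤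
      c * Real.exp (-(ρ * g.dist y y')) := by
  have h := conv_exp_le (ρ₁ := ρ₂) (ρ₂ := ρ₁) htri hd hrow hρ hρ₁ hρ₂ y' y
  calc ∑ y'' : g.Site, Real.exp (-(ρ₁ * g.dist y y'')) * Real.exp (-(ρ₂ * g.dist y'' y'))
      = ∑ y'' : g.Site, Real.exp (-(ρ₂ * g.dist y' y'')) * Real.exp (-(ρ₁ * g.dist y'' y)) :=
        Finset.sum_congr rfl fun y'' _ => by rw [hsym y y'', hsym y'' y', mul_comm]
    _ ≤ c * Real.exp (-(ρ * g.dist y' y)) := h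
    _ = c * Real.exp (-(ρ * g.dist y y')) := by rw [hsym y' y]

/-- Composition with rates, MIRRORED: T₁ (a₁e^{−ρ₁d}) after T₂ (a₂e^{−ρ₂d}) has κ₂a₁a₂c·e^{−ρd} for ρ ≤ ρ₁,
ρ + σ ≤ ρ₂ — the margin σ donated by the INNER factor (md §3.2 (C4), "mirror"). [cite: Balaban1984PropagatorsII, (2.52)–(2.56) pp.232–233] -/
theorem hasMaj_comp_exp_mirror {b₁ : BlockNorm g F₁} {b₂ : BlockNorm g F₂} {b₃ : BlockNorm g F₃}
    {T₁ : F₂ →ₗ[ℝ] F₃} {T₂ : F₁ →ₗ[ℝ] F₂} {a₁ a₂ ρ₁ ρ₂ ρ σ c : ℝ} (hsym : DistSymm g)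
    (htri : Triangle254 g) (hd : ∀ a b : g.Site, 0 ≤ g.dist a b) (hrow : RowSum g σ c)
    (ha₁ : 0 ≤ a₁) (ha₂ : 0 ≤ a₂) (hρ : 0 ≤ ρ) (hρ₁ : ρ ≤ ρ₁) (hρ₂ : ρ + σ ≤ ρ₂)
    (h₁ : HasMaj b₂ b₃ T₁ (fun a b => a₁ * Real.exp (-(ρ₁ * g.dist a b))))
    (h₂ : HasMaj b₁ b₂ T₂ (fun a b => a₂ * Real.exp (-(ρ₂ * g.dist a b)))) :
    HasMaj b₁ b₃ (T₁ ∘ₗ T₂) (fun a b => b₂.κ * a₁ * a₂ * c * Real.exp (-(ρ * g.dist a b))) := by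
  refine (hasMaj_comp h₁ h₂ fun a b => mul_nonneg ha₁ (Real.exp_nonneg _)).mono fun a b => ?_
  have hconv := conv_exp_le_mirror hsym htri hd hrow hρ hρ₁ hρ₂ a b
  calc ∑ y'' : g.Site, a₁ * Real.exp (-(ρ₁ * g.dist a y'')) * (b₂.κ * (a₂ * Real.exp (-(ρ₂ * g.dist y'' b))))
      = b₂.κ * a₁ * a₂ *
          ∑ y'' : g.Site, Real.exp (-(ρ₁ * g.dist a y'')) * Real.exp (-(ρ₂ * g.dist y'' b)) := by
        rw [Finset.mul_sum]; exact Finset.sum_congr rfl fun y'' _ => by ring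
    _ ≤ b₂.κ * a₁ * a₂ * (c * Real.exp (-(ρ * g.dist a b))) :=
        mul_le_mul_of_nonneg_left hconv (mul_nonneg (mul_nonneg b₂.κ_nonneg ha₁) ha₂)
    _ = _ := by ring

/-- **THE TRANSFER OF p. 398 IN MAJORANT FORM** (md §3.2 (C3)): a factor (L^{j′}η/L^jη)^t inside a majorant is absorbed
at the cost L^t and the rate αδ₀, by [4] (2.60) under the largeness t·log L ≤ αδ₀RM (cell condition C-RM_t).
[cite: Balaban1985BackgroundPropagators, p.398 (remark after (3.47)); Balaban1984PropagatorsII, Lemma 2.1 (2.60) p.234] -/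
theorem HasMaj.transfer {b₁ : BlockNorm g F₁} {b₂ : BlockNorm g F₂} {T : F₁ →ₗ[ℝ] F₂}
    {C : g.Site → g.Site → ℝ} {δ₀ α ρ : ℝ} (h260 : Ineq260 g δ₀ α) (hαδ : 0 ≤ α * δ₀)
    (hd : ∀ a b : g.Site, 0 ≤ g.dist a b) (hL : 1 ≤ g.L) (hη : 0 < g.eta) (t : ℕ)
    (hRM : (t : ℝ) * Real.log g.L ≤ α * δ₀ * g.R * g.M) (hC : ∀ y y', 0 ≤ C y y')
    (h : HasMaj b₁ b₂ T
      (fun y y' => C y y' * (g.len y' ^ t * (g.len y ^ t)⁻¹) * Real.exp (-(ρ * g.dist y y')))) :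
    HasMaj b₁ b₂ T (fun y y' => C y y' * g.L ^ t * Real.exp (-((ρ - α * δ₀) * g.dist y y'))) := by
  have hL0 : 0 < g.L := lt_of_lt_of_le one_pos hL
  have hlen : ∀ z : g.Site, 0 < g.len z := fun z => by
    rw [B6.Geometry.len]; exact mul_pos (pow_pos hL0 _) hη
  refine h.mono fun y y' => ?_
  have ht := B9SectDL2Decay.len_pow_le_of_ineq260 h260 hαδ hd hL hη.le t hRM y y'
  have hratio : g.len y' ^ t * (g.len y ^ t)⁻¹ ≤ g.L ^ t * Real.exp (α * δ₀ * g.dist y y') := by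
    rw [← div_eq_mul_inv, div_le_iff₀ (pow_pos (hlen y) t)]
    calc g.len y' ^ t ≤ g.L ^ t * g.len y ^ t * Real.exp (α * δ₀ * g.dist y y') := ht
      _ = g.L ^ t * Real.exp (α * δ₀ * g.dist y y') * g.len y ^ t := by ring
  calc C y y' * (g.len y' ^ t * (g.len y ^ t)⁻¹) * Real.exp (-(ρ * g.dist y y'))
      ≤ C y y' * (g.L ^ t * Real.exp (α * δ₀ * g.dist y y')) * Real.exp (-(ρ * g.dist y y')) :=
        mul_le_mul_of_nonneg_right (mul_le_mul_of_nonneg_left hratio (hC y y')) (Real.exp_nonneg _)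
    _ = C y y' * g.L ^ t * Real.exp (-((ρ - α * δ₀) * g.dist y y')) := by
        rw [show -((ρ - α * δ₀) * g.dist y y') = α * δ₀ * g.dist y y' + -(ρ * g.dist y y') by ring,
          Real.exp_add]
        ring

/-- The transfer for the inverse ratio (L^jη/L^{j′}η)^t (same cost and rate; [4] (2.60) is symmetric in j, j′).
[cite: Balaban1985BackgroundPropagators, p.398 (remark after (3.47)); Balaban1984PropagatorsII, Lemma 2.1 (2.60) p.234] -/
theorem HasMaj.transfer_mirror {b₁ : BlockNorm g F₁} {b₂ : BlockNorm g F₂} {T : F₁ →ₗ[ℝ] F₂}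
    {C : g.Site → g.Site → ℝ} {δ₀ α ρ : ℝ} (hsym : DistSymm g) (h260 : Ineq260 g δ₀ α) (hαδ : 0 ≤ α * δ₀)
    (hd : ∀ a b : g.Site, 0 ≤ g.dist a b) (hL : 1 ≤ g.L) (hη : 0 < g.eta) (t : ℕ)
    (hRM : (t : ℝ) * Real.log g.L ≤ α * δ₀ * g.R * g.M) (hC : ∀ y y', 0 ≤ C y y')
    (h : HasMaj b₁ b₂ T
      (fun y y' => C y y' * (g.len y ^ t * (g.len y' ^ t)⁻¹) * Real.exp (-(ρ * g.dist y y')))) :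
    HasMaj b₁ b₂ T (fun y y' => C y y' * g.L ^ t * Real.exp (-((ρ - α * δ₀) * g.dist y y'))) := by
  have hL0 : 0 < g.L := lt_of_lt_of_le one_pos hL
  have hlen : ∀ z : g.Site, 0 < g.len z := fun z => by
    rw [B6.Geometry.len]; exact mul_pos (pow_pos hL0 _) hη
  refine h.mono fun y y' => ?_
  have ht := B9SectDL2Decay.len_pow_le_of_ineq260 h260 hαδ hd hL hη.le t hRM y' y
  rw [hsym y' y] at ht
  have hratio : g.len y ^ t * (g.len y' ^ t)⁻¹ ≤ g.L ^ t * Real.exp (α * δ₀ * g.dist y y') := by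
    rw [← div_eq_mul_inv, div_le_iff₀ (pow_pos (hlen y') t)]
    calc g.len y ^ t ≤ g.L ^ t * g.len y' ^ t * Real.exp (α * δ₀ * g.dist y y') := ht
      _ = g.L ^ t * Real.exp (α * δ₀ * g.dist y y') * g.len y' ^ t := by ring
  calc C y y' * (g.len y ^ t * (g.len y' ^ t)⁻¹) * Real.exp (-(ρ * g.dist y y'))
      ≤ C y y' * (g.L ^ t * Real.exp (α * δ₀ * g.dist y y')) * Real.exp (-(ρ * g.dist y y')) :=
        mul_le_mul_of_nonneg_right (mul_le_mul_of_nonneg_left hratio (hC y y')) (Real.exp_nonneg _)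
    _ = C y y' * g.L ^ t * Real.exp (-((ρ - α * δ₀) * g.dist y y')) := by
        rw [show -((ρ - α * δ₀) * g.dist y y') = α * δ₀ * g.dist y y' + -(ρ * g.dist y y') by ring,
          Real.exp_add]
        ring

/-- **(3.47) FROM (3.42) AND LEMMA 2.1** — the printed *"It is easy to see that the global inequalities (3.47) are
consequences of the local ones (3.42) and Lemma 2.1"* (p. 398), block-majorant content: a majorant Ce^{−ρd(y,y′)}
with ρ ≥ σ bounds the size of Tf near EVERY y by Cκ₁c × (the sup over y′ of the size of f near y′); with the rescaled
norms of §1 this is |T f|_{(p+γ)} ≤ Cκ₁c|f|_{(γ)} once the weights are transferred (`HasMaj.transfer`).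
[cite: Balaban1985BackgroundPropagators, (3.47) p.398; Balaban1984PropagatorsII, (2.61) p.234] -/
theorem global_bound {b₁ : BlockNorm g F₁} {b₂ : BlockNorm g F₂} {T : F₁ →ₗ[ℝ] F₂} {C ρ σ c m : ℝ}
    (hd : ∀ a b : g.Site, 0 ≤ g.dist a b) (hrow : RowSum g σ c) (hC : 0 ≤ C) (hρ : σ ≤ ρ)
    (h : HasMaj b₁ b₂ T (fun y y' => C * Real.exp (-(ρ * g.dist y y')))) (f : F₁) (hm : ∀ y', b₁.loc y' f ≤ m)
    (y : g.Site) : b₂.loc y (T f) ≤ C * b₁.κ * c * m := by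
  have hm0 : 0 ≤ m := (b₁.loc_nonneg y f).trans (hm y)
  have hb := h.bound (fun a b => mul_nonneg hC (Real.exp_nonneg _)) f y
  have hrow' : RowSum g ρ c := hrow.mono hd hρ
  calc b₂.loc y (T f) ≤ ∑ y' : g.Site, C * Real.exp (-(ρ * g.dist y y')) * (b₁.κ * b₁.loc y' f) := hb
    _ ≤ ∑ y' : g.Site, C * Real.exp (-(ρ * g.dist y y')) * (b₁.κ * m) :=
        Finset.sum_le_sum fun y' _ =>
          mul_le_mul_of_nonneg_left (mul_le_mul_of_nonneg_left (hm y') b₁.κ_nonneg)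
            (mul_nonneg hC (Real.exp_nonneg _))
    _ = C * b₁.κ * m * ∑ y' : g.Site, Real.exp (-(ρ * g.dist y y')) := by
        rw [Finset.mul_sum]; exact Finset.sum_congr rfl fun y' _ => by ring
    _ ≤ C * b₁.κ * m * c :=
        mul_le_mul_of_nonneg_left (hrow' y) (mul_nonneg (mul_nonneg hC b₁.κ_nonneg) hm0)
    _ = C * b₁.κ * c * m := by ring

end Rates

/-! ## 3. The factored Neumann series: G = G₀ + 𝒢𝒯G ((3.130) with G₀Δ′_π = 𝒢∘𝒯) -/

section Factored

variable {F₀ F P F₃ : Type} [AddCommGroup F₀] [Module ℝ F₀] [AddCommGroup F] [Module ℝ F]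
  [AddCommGroup P] [Module ℝ P] [AddCommGroup F₃] [Module ℝ F₃]

/-- (3.130), algebra, factored: G = G₀ + 𝒢𝒯G gives, for every right factor 𝒳, G𝒳 = G₀𝒳 + (𝒢𝒯)(G𝒳) — the linear
fixed-point equation of `B11SectG.neumann_majorant` with K′ = 𝒢𝒯, S = G₀𝒳. [cite: Balaban1985BackgroundPropagators, (3.130) p.421] -/
theorem factored_rightEntry_fix {G G0 : Module.End ℝ F} {𝒯 : F →ₗ[ℝ] P} {𝒢 : P →ₗ[ℝ] F} (Fop : F₀ →ₗ[ℝ] F)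
    (hfix : G = G0 + 𝒢 ∘ₗ 𝒯 ∘ₗ G) :
    G ∘ₗ Fop = G0 ∘ₗ Fop + (𝒢 ∘ₗ 𝒯) ∘ₗ (G ∘ₗ Fop) := by
  have hpt : ∀ v : F, G v = G0 v + 𝒢 (𝒯 (G v)) := fun v => by
    conv_lhs => rw [hfix]
    simp only [LinearMap.add_apply, LinearMap.comp_apply]
  ext v
  simp only [LinearMap.comp_apply, LinearMap.add_apply]
  exact hpt (Fop v)

/-- (3.130), algebra, factored, two-sided: EG𝒳 = EG₀𝒳 + (E𝒢)(𝒯(G𝒳)). [cite: Balaban1985BackgroundPropagators, (3.130) p.421] -/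
theorem factored_entry_fix {G G0 : Module.End ℝ F} {𝒯 : F →ₗ[ℝ] P} {𝒢 : P →ₗ[ℝ] F} (Eop : F →ₗ[ℝ] F₃)
    (Fop : F₀ →ₗ[ℝ] F) (hfix : G = G0 + 𝒢 ∘ₗ 𝒯 ∘ₗ G) :
    Eop ∘ₗ G ∘ₗ Fop = Eop ∘ₗ G0 ∘ₗ Fop + (Eop ∘ₗ 𝒢) ∘ₗ (𝒯 ∘ₗ (G ∘ₗ Fop)) := by
  have hpt : ∀ v : F, G v = G0 v + 𝒢 (𝒯 (G v)) := fun v => by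
    conv_lhs => rw [hfix]
    simp only [LinearMap.add_apply, LinearMap.comp_apply]
  ext v
  simp only [LinearMap.comp_apply, LinearMap.add_apply]
  conv_lhs => rw [hpt (Fop v)]
  rw [map_add]

/-- THE PERTURBATION STEP 𝒦 = 𝒢∘𝒯 : 𝔠 → 𝔠 (md §5 Step 1): 𝒯 : 𝔠 → 𝔭 with majorant C_𝒯e^{−δ_𝒯d} (C_𝒯 = O(1)Mα₀, from
the printed (3.42)₃, (3.44) for G′, (3.49), (3.36)) followed by 𝒢 : 𝔭 → 𝔠 with B_𝒢e^{−δ_𝒢d} (from (3.42)₁,₃, (3.43)₂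
for G₀) has majorant κ_𝔭B_𝒢C_𝒯c·e^{−δd} for δ ≤ δ_𝒯, δ + σ ≤ δ_𝒢 — one use of [4] (2.54) + (2.61).
[cite: Balaban1985BackgroundPropagators, (3.130)–(3.131) pp.421–422; Balaban1984PropagatorsII, Lemma 2.1 p.234] -/
theorem step_majorant {bF : BlockNorm g F} {bP : BlockNorm g P} {𝒯 : F →ₗ[ℝ] P} {𝒢 : P →ₗ[ℝ] F}
    {CT BG δT δG δ σ c : ℝ} (htri : Triangle254 g) (hd : ∀ a b : g.Site, 0 ≤ g.dist a b)
    (hrow : RowSum g σ c) (hCT : 0 ≤ CT) (hBG : 0 ≤ BG) (hδ : 0 ≤ δ) (hδT : δ ≤ δT) (hδG : δ + σ ≤ δG)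
    (hT : HasMaj bF bP 𝒯 (fun a b => CT * Real.exp (-(δT * g.dist a b))))
    (hG : HasMaj bP bF 𝒢 (fun a b => BG * Real.exp (-(δG * g.dist a b)))) :
    HasMaj bF bF (𝒢 ∘ₗ 𝒯) (fun a b => bP.κ * BG * CT * c * Real.exp (-(δ * g.dist a b))) :=
  hasMaj_comp_exp htri hd hrow hBG hCT hδ hδT hδG hG hT

/-- **RIGHT ENTRIES OF G WITH DECAY, FACTORED FORM** (md §5 Step 2): if 𝒦 = 𝒢𝒯 has majorant θe^{−δd} on the state
norm 𝔠, the entry G₀𝒳 of G₀ has Ae^{−ρ_Sd} into 𝔠 (Theorem 3.3), ρ ≤ ρ_S, ρ + σ ≤ δ, G𝒳 is a priori bounded (finite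
lattice: the norm-convergent series (3.130)) and q := κ_𝔠θc < 1, then G𝒳 has majorant A(1 − q)⁻¹e^{−ρd}.
KERNEL-CHECKED from `B11SectG.neumann_majorant`. [cite: Balaban1985BackgroundPropagators, (3.130) p.421 + Thm 3.12 p.423;
Balaban1984PropagatorsII, Lemma 2.1 p.234] -/
theorem rightEntry_majorant {b₀ : BlockNorm g F₀} {bF : BlockNorm g F} {G G0 : Module.End ℝ F}
    {𝒯 : F →ₗ[ℝ] P} {𝒢 : P →ₗ[ℝ] F} {Fop : F₀ →ₗ[ℝ] F} {θ A M₀ δ ρS ρ σ c : ℝ}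
    (htri : Triangle254 g) (hd : ∀ a b : g.Site, 0 ≤ g.dist a b) (hrow : RowSum g σ c)
    (hθ : 0 ≤ θ) (hA : 0 ≤ A) (hM₀ : 0 ≤ M₀) (hρ : 0 ≤ ρ) (hρS : ρ ≤ ρS) (hρδ : ρ + σ ≤ δ)
    (hK : HasMaj bF bF (𝒢 ∘ₗ 𝒯) (fun a b => θ * Real.exp (-(δ * g.dist a b))))
    (hS : HasMaj b₀ bF (G0 ∘ₗ Fop) (fun a b => A * Real.exp (-(ρS * g.dist a b))))
    (hfix : G = G0 + 𝒢 ∘ₗ 𝒯 ∘ₗ G)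
    (hap : HasMaj b₀ bF (G ∘ₗ Fop) (fun _ _ => M₀))
    (hq : bF.κ * θ * c < 1) :
    HasMaj b₀ bF (G ∘ₗ Fop) (fun a b => A * (1 - bF.κ * θ * c)⁻¹ * Real.exp (-(ρ * g.dist a b))) :=
  neumann_majorant htri hd hrow hθ hA hM₀ hρ hρδ hK (hS.of_rate_le hd hA hρS)
    (factored_rightEntry_fix Fop hfix) hap hq

/-- Right entries, assembled from the two factor majorants (md §5 Steps 1–2 in one statement): 𝒯 (C_𝒯, δ_𝒯), 𝒢 (B_𝒢,
δ_𝒢), G₀𝒳 (A, ρ_S), with ρ ≤ ρ_S, ρ + σ ≤ δ_𝒯, ρ + 2σ ≤ δ_𝒢 and q := κ_𝔠(κ_𝔭B_𝒢C_𝒯c)c < 1 ⇒ G𝒳 has A(1 − q)⁻¹e^{−ρd}.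
[cite: Balaban1985BackgroundPropagators, (3.130) p.421 + Thm 3.12 p.423; Balaban1984PropagatorsII, Lemma 2.1 p.234] -/
theorem rightEntry_of_factored {b₀ : BlockNorm g F₀} {bF : BlockNorm g F} {bP : BlockNorm g P}
    {G G0 : Module.End ℝ F} {𝒯 : F →ₗ[ℝ] P} {𝒢 : P →ₗ[ℝ] F} {Fop : F₀ →ₗ[ℝ] F}
    {CT BG A M₀ δT δG ρS ρ σ c : ℝ}
    (htri : Triangle254 g) (hd : ∀ a b : g.Site, 0 ≤ g.dist a b) (hrow : RowSum g σ c)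
    (hCT : 0 ≤ CT) (hBG : 0 ≤ BG) (hA : 0 ≤ A) (hM₀ : 0 ≤ M₀) (hρ : 0 ≤ ρ) (hσ : 0 ≤ σ) (hρS : ρ ≤ ρS)
    (hρT : ρ + σ ≤ δT) (hρG : ρ + 2 * σ ≤ δG)
    (hT : HasMaj bF bP 𝒯 (fun a b => CT * Real.exp (-(δT * g.dist a b))))
    (hG : HasMaj bP bF 𝒢 (fun a b => BG * Real.exp (-(δG * g.dist a b))))
    (hS : HasMaj b₀ bF (G0 ∘ₗ Fop) (fun a b => A * Real.exp (-(ρS * g.dist a b))))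
    (hfix : G = G0 + 𝒢 ∘ₗ 𝒯 ∘ₗ G)
    (hap : HasMaj b₀ bF (G ∘ₗ Fop) (fun _ _ => M₀))
    (hq : bF.κ * (bP.κ * BG * CT * c) * c < 1) :
    HasMaj b₀ bF (G ∘ₗ Fop)
      (fun a b => A * (1 - bF.κ * (bP.κ * BG * CT * c) * c)⁻¹ * Real.exp (-(ρ * g.dist a b))) := by
  have hc : 0 ≤ c ∨ IsEmpty g.Site := by
    by_cases hne : Nonempty g.Site
    · exact Or.inl (hrow.nonneg (Classical.arbitrary _))
    · exact Or.inr (not_nonempty_iff.mp hne)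
  rcases hc with hc | hemp
  swap
  · intro y' μ hμ y
    exact (IsEmpty.false y).elim
  have hK := step_majorant (δ := ρ + σ) htri hd hrow hCT hBG (by linarith) hρT (by linarith) hT hG
  exact rightEntry_majorant htri hd hrow
    (mul_nonneg (mul_nonneg (mul_nonneg bP.κ_nonneg hBG) hCT) hc) hA hM₀ hρ hρS le_rfl hK hS hfix hap hq

/-- **TWO-SIDED ENTRIES OF G WITH DECAY, FACTORED FORM** (md §5 Steps 4–8): EG𝒳 = EG₀𝒳 + (E𝒢)(𝒯(G𝒳)) with the printed
E𝒳-entry of G₀ (A_{E𝒳}e^{−ρ₁d}, Theorem 3.3: for E = ∇_U, 𝒳 = ∇*_U this IS the printed mixed entry (3.44)/(3.45) of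
G₀), the output map E𝒢 : 𝔭′ → out (B_Ee^{−ρ_Ed}, from (3.42)₂/(3.43)₁/(3.44)/(3.45) for G₀ — the ONLY place a mixed
kernel with Hölder data is evaluated), 𝒯 : 𝔠 → 𝔭′ (C′_𝒯e^{−δ_𝒯d}) and the right entry G𝒳 (A′e^{−ρd},
`rightEntry_majorant`), ρ + σ ≤ min(δ_𝒯, ρ_E), ρ ≤ ρ₁: EG𝒳 has majorant (A_{E𝒳} + κ_{𝔭′}B_E·κ_𝔠C′_𝒯A′c·c)e^{−ρd}.
KERNEL-CHECKED (two uses of (2.54) + (2.61)). [cite: Balaban1985BackgroundPropagators, (3.130) p.421 + Thm 3.12 p.423;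
Balaban1984PropagatorsII, Lemma 2.1 p.234] -/
theorem entry_majorant {b₀ : BlockNorm g F₀} {bF : BlockNorm g F} {bP' : BlockNorm g P} {b₃ : BlockNorm g F₃}
    {G G0 : Module.End ℝ F} {𝒯 : F →ₗ[ℝ] P} {𝒢 : P →ₗ[ℝ] F} {Eop : F →ₗ[ℝ] F₃} {Fop : F₀ →ₗ[ℝ] F}
    {BE CT AEF A' ρE δT ρ₁ ρ σ c : ℝ}
    (htri : Triangle254 g) (hd : ∀ a b : g.Site, 0 ≤ g.dist a b) (hrow : RowSum g σ c)
    (hBE : 0 ≤ BE) (hCT : 0 ≤ CT) (hAEF : 0 ≤ AEF) (hA' : 0 ≤ A') (hρ : 0 ≤ ρ)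
    (hρT : ρ + σ ≤ δT) (hρE : ρ + σ ≤ ρE) (hρ₁ : ρ ≤ ρ₁)
    (hE : HasMaj bP' b₃ (Eop ∘ₗ 𝒢) (fun a b => BE * Real.exp (-(ρE * g.dist a b))))
    (hT : HasMaj bF bP' 𝒯 (fun a b => CT * Real.exp (-(δT * g.dist a b))))
    (hEF : HasMaj b₀ b₃ (Eop ∘ₗ G0 ∘ₗ Fop) (fun a b => AEF * Real.exp (-(ρ₁ * g.dist a b))))
    (hGF : HasMaj b₀ bF (G ∘ₗ Fop) (fun a b => A' * Real.exp (-(ρ * g.dist a b))))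
    (hfix : G = G0 + 𝒢 ∘ₗ 𝒯 ∘ₗ G) :
    HasMaj b₀ b₃ (Eop ∘ₗ G ∘ₗ Fop)
      (fun a b => (AEF + bP'.κ * BE * (bF.κ * CT * A' * c) * c) * Real.exp (-(ρ * g.dist a b))) := by
  -- 𝒯(G𝒳): majorant κ_𝔠C′_𝒯A′c·e^{−ρd}
  have h1 : HasMaj b₀ bP' (𝒯 ∘ₗ (G ∘ₗ Fop))
      (fun a b => bF.κ * CT * A' * c * Real.exp (-(ρ * g.dist a b))) :=
    hasMaj_comp_exp (b₁ := b₀) (b₂ := bF) (b₃ := bP') htri hd hrow hCT hA' hρ le_rfl hρT hT hGF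
  have hc : 0 ≤ c ∨ IsEmpty g.Site := by
    by_cases hne : Nonempty g.Site
    · exact Or.inl (hrow.nonneg (Classical.arbitrary _))
    · exact Or.inr (not_nonempty_iff.mp hne)
  rcases hc with hc | hemp
  swap
  · intro y' μ hμ y
    exact (IsEmpty.false y).elim
  -- (E𝒢)(𝒯G𝒳): majorant κ_{𝔭′}B_E(κ_𝔠C′_𝒯A′c)c·e^{−ρd}
  have h2 : HasMaj b₀ b₃ ((Eop ∘ₗ 𝒢) ∘ₗ (𝒯 ∘ₗ (G ∘ₗ Fop)))
      (fun a b => bP'.κ * BE * (bF.κ * CT * A' * c) * c * Real.exp (-(ρ * g.dist a b))) :=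
    hasMaj_comp_exp (b₁ := b₀) (b₂ := bP') (b₃ := b₃) htri hd hrow hBE
      (mul_nonneg (mul_nonneg (mul_nonneg bF.κ_nonneg hCT) hA') hc) hρ le_rfl hρE hE h1
  have hEF' : HasMaj b₀ b₃ (Eop ∘ₗ G0 ∘ₗ Fop) (fun a b => AEF * Real.exp (-(ρ * g.dist a b))) :=
    hEF.of_rate_le hd hAEF hρ₁
  have hsum := hEF'.add h2
  rw [← factored_entry_fix Eop Fop hfix] at hsum
  refine hsum.mono fun a b => le_of_eq ?_
  ring

/-- THE HÖLDER DATA OF 𝒯 APPLIED TO THE SOLUTION (md §5 Step 3): 𝒯(G𝒳) : b₀ → 𝔭′ has κ_𝔠C′_𝒯A′c·e^{−ρd} —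
the quantity (φ′, ψ′) whose cut pieces feed the printed output entries of G₀. [cite: Balaban1985BackgroundPropagators, (3.130) p.421] -/
theorem solutionData_majorant {b₀ : BlockNorm g F₀} {bF : BlockNorm g F} {bP' : BlockNorm g P}
    {G : Module.End ℝ F} {𝒯 : F →ₗ[ℝ] P} {Fop : F₀ →ₗ[ℝ] F} {CT A' δT ρ σ c : ℝ}
    (htri : Triangle254 g) (hd : ∀ a b : g.Site, 0 ≤ g.dist a b) (hrow : RowSum g σ c)
    (hCT : 0 ≤ CT) (hA' : 0 ≤ A') (hρ : 0 ≤ ρ) (hρT : ρ + σ ≤ δT)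
    (hT : HasMaj bF bP' 𝒯 (fun a b => CT * Real.exp (-(δT * g.dist a b))))
    (hGF : HasMaj b₀ bF (G ∘ₗ Fop) (fun a b => A' * Real.exp (-(ρ * g.dist a b)))) :
    HasMaj b₀ bP' (𝒯 ∘ₗ (G ∘ₗ Fop)) (fun a b => bF.κ * CT * A' * c * Real.exp (-(ρ * g.dist a b))) :=
  hasMaj_comp_exp (b₁ := b₀) (b₂ := bF) (b₃ := bP') htri hd hrow hCT hA' hρ le_rfl hρT hT hGF

end Factored

/-! ## 4. The smallness *"for α₀ sufficiently small"* made explicit: q ≤ ½ and (1 − q)⁻¹ ≤ 2 -/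

section Smallness

/-- If q ≤ ½ then (1 − q)⁻¹ ≤ 2. [folklore] -/
theorem inv_one_sub_le_two {q : ℝ} (hq : q ≤ 1 / 2) : (1 - q)⁻¹ ≤ 2 := by
  have h1 : (1 : ℝ) / 2 ≤ 1 - q := by linarith
  have hpos : (0 : ℝ) < 1 - q := lt_of_lt_of_le (by norm_num) h1
  rw [inv_le_comm₀ hpos (by norm_num : (0 : ℝ) < 2)]
  linarith

/-- If q ≤ ½ then q < 1 (the hypothesis of `B11SectG.neumann_majorant`). [folklore] -/
theorem lt_one_of_le_half {q : ℝ} (hq : q ≤ 1 / 2) : q < 1 := by linarith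

/-- The LOCATED smallness of Theorem 3.12 (md §5: a_S := (2D)⁻¹ with D = κ_𝔠κ_𝔭B_𝒢C_𝒯c², θ = B_𝒢·C_𝒯Mα₀·…): for
D ≥ 0 and m ≤ (2D)⁻¹ (when D > 0) the ratio q = D·m is ≤ ½. [cite: Balaban1985BackgroundPropagators, Thm 3.12 p.423 ("for α₀ sufficiently small")] -/
theorem mul_le_half_of_le_inv {D m : ℝ} (hD : 0 ≤ D) (hsmall : 0 < D → m ≤ (2 * D)⁻¹) :
    D * m ≤ 1 / 2 := by
  rcases eq_or_lt_of_le hD with hD0 | hDpos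
  · rw [← hD0, zero_mul]; norm_num
  · have h := hsmall hDpos
    calc D * m ≤ D * (2 * D)⁻¹ := mul_le_mul_of_nonneg_left h hD
      _ = 1 / 2 := by field_simp

/-- The constant of the right entries under the located smallness: A(1 − q)⁻¹ ≤ 2A. [folklore] -/
theorem const_le_two_mul {A q : ℝ} (hA : 0 ≤ A) (hq : q ≤ 1 / 2) : A * (1 - q)⁻¹ ≤ 2 * A := by
  calc A * (1 - q)⁻¹ ≤ A * 2 := mul_le_mul_of_nonneg_left (inv_one_sub_le_two hq) hA
    _ = 2 * A := by ring

end Smallness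

/-! ## 5. The printed shape: Theorem 3.12, sup entry (3.42)₁ for G with decay, from the factored hypotheses -/

section Shape

variable {F₀ F P : Type} [AddCommGroup F₀] [Module ℝ F₀] [AddCommGroup F] [Module ℝ F]
  [AddCommGroup P] [Module ℝ P]

/-- **THEOREM 3.12, RIGHT ENTRIES, PRINTED SHAPE** (md THEOREM S (R1)/(R3) with the constant 2A): under the located
smallness q ≤ ½ the right entry G𝒳 has majorant 2A·e^{−ρd} whenever G₀𝒳 has A·e^{−ρ_Sd} — *"Thus we have Theorem 3.3.
for G"* for the entries reachable from the state norm, with the constant doubled and the rate ρ = min(ρ_S, δ_𝒯 − σ,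
δ_𝒢 − 2σ). [cite: Balaban1985BackgroundPropagators, Thm 3.12 p.423 + (3.130) p.421; Balaban1984PropagatorsII, Lemma 2.1 p.234] -/
theorem thm312_rightEntry_shape {b₀ : BlockNorm g F₀} {bF : BlockNorm g F} {bP : BlockNorm g P}
    {G G0 : Module.End ℝ F} {𝒯 : F →ₗ[ℝ] P} {𝒢 : P →ₗ[ℝ] F} {Fop : F₀ →ₗ[ℝ] F}
    {CT BG A M₀ δT δG ρS ρ σ c : ℝ}
    (htri : Triangle254 g) (hd : ∀ a b : g.Site, 0 ≤ g.dist a b) (hrow : RowSum g σ c)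
    (hCT : 0 ≤ CT) (hBG : 0 ≤ BG) (hA : 0 ≤ A) (hM₀ : 0 ≤ M₀) (hρ : 0 ≤ ρ) (hσ : 0 ≤ σ) (hρS : ρ ≤ ρS)
    (hρT : ρ + σ ≤ δT) (hρG : ρ + 2 * σ ≤ δG)
    (hT : HasMaj bF bP 𝒯 (fun a b => CT * Real.exp (-(δT * g.dist a b))))
    (hG : HasMaj bP bF 𝒢 (fun a b => BG * Real.exp (-(δG * g.dist a b))))
    (hS : HasMaj b₀ bF (G0 ∘ₗ Fop) (fun a b => A * Real.exp (-(ρS * g.dist a b))))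
    (hfix : G = G0 + 𝒢 ∘ₗ 𝒯 ∘ₗ G)
    (hap : HasMaj b₀ bF (G ∘ₗ Fop) (fun _ _ => M₀))
    (hq : bF.κ * (bP.κ * BG * CT * c) * c ≤ 1 / 2) :
    HasMaj b₀ bF (G ∘ₗ Fop) (fun a b => 2 * A * Real.exp (-(ρ * g.dist a b))) :=
  (rightEntry_of_factored htri hd hrow hCT hBG hA hM₀ hρ hσ hρS hρT hρG hT hG hS hfix hap
      (lt_one_of_le_half hq)).mono
    fun _ _ => mul_le_mul_of_nonneg_right (const_le_two_mul hA hq) (Real.exp_nonneg _)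

end Shape

end Literature.MathematicalPhysics.QuantumFieldTheory.Balaban1983to89.B9SectDSup
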